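import Literature.Probability.Percolation.MarkedLoopTripodBasisFive
import Literature.Probability.Percolation.MarkedLoopNecessityFive
import HarnessLib

/-!
# The fan at five marks IS the lane's five-point observable («FAN-IS-FIVEPOINT»)

Topic `Literature/Probability/Percolation`; bridge between the generic-`k` marked-loop layer (`MarkedLoops.*`) and the five-point files
(`FivePoint.*`). HOLO-K (`MarkedLoopHolomorphy.lean`) defines for every odd `k = 2l+1` the FAN weight `fanWt l` and proves
`holomorphicW_fan` (the fan obeys the tripod law, hence its class-weighted `k`-disorder observable `ObsW D (fanWt l)` is discretely
holomorphic on every `k`-marked domain). The five-point files define, for five marks, the pattern probabilities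
`patternProb D j c m x x' = H_{j,M}(e)` of critical site percolation with the five-point boundary condition and the lane's blind-found
SPARSE OBSERVABLE `sparseObs D j c x x' = F_j = H_{j,A} − τ² H_{j+1,B} − τ H_{j−1,B}` (`FiveMarkedLoops.lean`), holomorphic at interior faces
(`FivePointHolomorphy.hexFivePointHolomorphy_holds`). This file identifies the two at `k = 5`:

* `§ FanFivePoint` — ★ `linkRel_eq_adjRel₅_iff` / `inClass_iff_inClassX_and_linkRel`: the PATTERN dictionary at five marks — for a
  configuration whose strand from the mid-edge ends at `y_j`, the link relation is the adjacent pairs `adjRel₅ j` iff `y_{j+1} ~ y_{j+2}`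
  (five-point class `(j, A)`) and the nested pairs `nestRel₅ j` iff `y_{j+1} ~ y_{j+4}` (class `(j, B)`) — via `relation_five` of
  `MarkedLoopTripodBasisFive` and `isPattern_linkRel` of `MarkedLoopTripodBasis`; ★ `patternCount_five_eq`: the pattern count of
  `(j; adj/nest)` at an interior edge equals `2^{#G} · patternProb D j c (A/B)` (the XOR space = `N5.loopSpace6` + the five-point transport
  `N5.sixTransport_holds` + `N5.ha_patternProb_eq_card_div`); `fanWt_two_adjRel₅`, ★ `restrictW_fanWt_two` (the fan is supported on the three
  patterns `(1; adj) ↦ τ²`, `(0; nest) ↦ −1`, `(2; nest) ↦ −τ⁴`); ★★★ `obsW_fanWt_two_eq`: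
  **`ObsW D (fanWt 2) v i = 2^{#G} · τ² · F₁(v, oppFace v i)`** at every edge of an interior face, for every colour convention `c` — THE
  GENERIC FAN AT FIVE MARKS IS `τ²` TIMES THE LANE'S FIVE-POINT OBSERVABLE `F₁`; ★★ `fivePoint_holomorphy_of_fan` — a SECOND PROOF of the
  five-point holomorphicity of `F₁` at interior faces from HOLO-K's generic mechanism (`Σ_i τ^i F₁(v, oppFace v i) = 0`; the tree's theorem
  indexes the neighbours by `ccwNbr`, the same contour up to a cyclic shift).
* `§ Classification` — with «TRIPOD-SOLVED-FIVE» (`tripodLaw_five_iff_exists_sum_fanR`: the five rotated fans are a basis of the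
  tripod-law solutions) and «TRIPOD-NECESSITY-FIVE» (`tripodLaw_iff_forall_holomorphicW_five`): ★★★ `forall_holomorphicW_iff_exists_sum_fanR` — a
  five-disorder class weight is discretely holomorphic on EVERY five-marked domain iff on the patterns it is a combination of the five rotated
  fans (a five-dimensional space), and ★★ `obsW_eq_sum_of_forall_holomorphicW` — its observable is then the same combination of the rotated fans'
  observables; ★★★★ `obsW_eq_sum_sparseObs_of_forall_holomorphicW` — hence `ObsW D wt = 2^{#G}·τ²·Σ_s g_s F_{1−s}` at every interior edge of every
  five-marked domain: THE DISCRETELY HOLOMORPHIC FIVE-DISORDER OBSERVABLES ARE EXACTLY THE COMBINATIONS OF THE LANE'S `F_0, …, F_4`.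
* `§ Rotations` — `loopSpace6_rotate`, `inClass_rotate`, ★ `patternProb_rotate` (`H_{j,M}` of `D.rotate` = `H_{j+1,M}` of `D`, proved on the loop side
  via the transport for both domains), `sparseObs_rotate`, `obsW_iterate_rotW_symm`, `sparseObs_iterate_rotate`, `iterate_rotW_symm_eq`, ★★★
  `obsW_rotW_fanWt_two_eq` — `ObsW D (rotW (rot^s) (fanWt 2)) = 2^{#G}·τ²·F_{1−s}`: the rotated fans are the rotated five-point observables.

The identification is the lane's (Khristoforov–Smirnov define `F` for three disorders; the five-point observable and the fan are lane objects).

## References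
* M. Khristoforov, S. Smirnov, *Percolation and O(1) loop model*, arXiv:2111.15612 (2021), §1.2 (arXiv v1 pp. 2–4: loop configurations, the
  link pattern, Lemma 2 = colourings ↔ loop configurations), §2 Definition 3 and Lemma 4 (p. 4), Remark 6 (p. 5).
* B. Bollobás, O. Riordan, *Percolation*, Cambridge University Press (2006), Ch. 7 §7.2.2 (pp. 191–195: marked discrete domains).

## Mathlib / tree
Tree: (`MarkedLoopLinkPatternLawFive.lean`'s `TXb_eq_loopSpace6` / `not_isCornerFace_of_mem_pair` are re-derived privately here, that module's olean being unbuilt),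
`MarkedLoopTripodBasisFive.lean` (`adjRel₅`, `nestRel₅`, `relation_five`, `isPattern_adjRel₅/nestRel₅`, `nestPat₅`, `fanWt_two_nestRel₅`),
`MarkedLoopTripodBasis.lean` (`isPattern_linkRel`, `patternCount`, `obsW_classWt_eq_sum_patternCount`, `obsW_classWt_restrictW`, `restrictW`, `obsWLin`, `classWtLin`),
`MarkedLoopNecessityFive.lean` (`tripodLaw_iff_forall_holomorphicW_five`), `MarkedLoopTripodBasisFive.lean` (`fanR`, `tripodLaw_five_iff_exists_sum_fanR`),
`FivePointNormalisation.lean` (`N5.loopSpace6`, `N5.InClass`, `N5.sixTransport_holds`), `FivePointHolomorphyFaces.lean` (`N5.ha_patternProb_eq_card_div`),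
`FiveMarkedLoops.lean` (`patternProb`, `sparseObs`, `tau`), `MarkedLoopHolomorphy.lean` (`fanWt`, `fanRel`, `holomorphicW_fan`, `mem_linkRel`),
`KhSThreeDisorderObservable.lean` (`TXb`, `InClassX`, `allSides_of_subset`), `MarkedLoopSpace.lean` (`eq_yc`, `yc_spec`, `not_mem_corners_iff`),
`TriFaceLabel.lean` (`faceEdge_oppFace`), `TriDiscreteDomain.lean` (`hexGraph_adj_oppFace`, `faceVertex_mem`). Mathlib: `Finset.filter_congr`,
`Finset.sum_ite_eq'`, `field_simp`, `linear_combination`.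
-/

open Finset

namespace Literature.Probability.Percolation.MarkedLoops

open Literature.Probability.Percolation Literature.Probability.LatticeModels
open Literature.Probability.Percolation.FivePoint (tau xiDeg XiLinked side sparseObs patternProb)
open TriMarkedDomain

section FanFivePoint

variable {D : TriMarkedDomain 5} {v : HexVertex} (hv : hexFaceVertices v ⊆ D.verts) (i : Fin 3)

/-- small facts in `ℤ/5`. [folklore] -/
private theorem fin5_pairs : ∀ j : Fin 5, j + 1 ≠ j + 2 ∧ j + 1 ≠ j + 4 ∧ (j + 1, j + 2) ∈ adjRel₅ j ∧ (j + 1, j + 2) ∉ nestRel₅ j ∧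
    (j + 1, j + 4) ∈ nestRel₅ j ∧ (j + 1, j + 4) ∉ adjRel₅ j := by
  unfold adjRel₅ nestRel₅; decide

/-- the two corner-face vocabularies agree (by `rfl`). [cite: BollobasRiordan2006, Ch. 7 §7.2.2 (pp. 191–195)] -/
private theorem isCornerFace_iff₅ (j : Fin 5) (F : HexVertex) : IsCornerFace D j F ↔ FivePoint.IsCornerFace D j F := Iff.rfl

include hv in
/-- neither face of the edge `{v, oppFace v i}` of an interior face is a corner face (both contain the two sites of the side, which lie in `G`).
(Adapted from `MarkedLoopLinkPatternLawFive.not_isCornerFace_of_mem_pair`, whose module is not imported here.) [cite: BollobasRiordan2006, Ch. 7 §7.2.2 (pp. 191–195)] -/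
private theorem not_isCornerFace_of_mem_pair₅ {s : HexVertex} (hs : s ∈ ({v, oppFace v i} : Finset HexVertex)) (j : Fin 5) :
    ¬ IsCornerFace D j s := by
  have h1 : faceVertex v (i + 1) ∈ D.verts := hv (faceVertex_mem v _)
  have h2 : faceVertex v (i + 2) ∈ D.verts := hv (faceVertex_mem v _)
  have hne : faceVertex v (i + 1) ≠ faceVertex v (i + 2) := fun h => by
    have := faceVertex_injective v h
    have h3 : ∀ i : Fin 3, i + 1 ≠ i + 2 := by decide
    exact h3 i this
  rw [Finset.mem_insert, Finset.mem_singleton] at hs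
  rcases hs with rfl | rfl
  · exact not_corner_of_two_mem D (faceVertex_mem _ _) (faceVertex_mem _ _) h1 h2 hne j
  · have hm1 : faceVertex v (i + 1) ∈ hexFaceVertices (oppFace v i) := by
      have : faceVertex v (i + 1) ∈ faceEdge v (oppFace v i) := by rw [faceEdge_oppFace]; simp
      exact (Finset.mem_inter.1 this).2
    have hm2 : faceVertex v (i + 2) ∈ hexFaceVertices (oppFace v i) := by
      have : faceVertex v (i + 2) ∈ faceEdge v (oppFace v i) := by rw [faceEdge_oppFace]; simp
      exact (Finset.mem_inter.1 this).2
    exact not_corner_of_two_mem D hm1 hm2 h1 h2 hne j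

include hv in
/-- the generic XOR space at the edge is the five-point six-odd-point space (adapted from `MarkedLoopLinkPatternLawFive.TXb_eq_loopSpace6`,
whose module is not imported here). [cite: KhristoforovSmirnov2021, §1.2 (arXiv v1 pp. 2–3)] -/
private theorem txb_eq_loopSpace6₅ {s : HexVertex} (hs : s ∈ ({v, oppFace v i} : Finset HexVertex)) :
    TXb D v i s = FivePoint.N5.loopSpace6 D (faceVertex v (i + 1)) (faceVertex v (i + 2)) s := by
  classical
  have hnc := not_isCornerFace_of_mem_pair₅ hv i hs
  ext ξ
  unfold TXb FivePoint.N5.loopSpace6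
  rw [mem_loopSpaceX, Finset.mem_filter, Finset.mem_powerset]
  refine and_congr Iff.rfl (forall₂_congr fun F _ => ?_)
  refine iff_congr Iff.rfl ?_
  by_cases hF : F = s
  · subst hF
    have hP : ¬ ∃ j : Fin 5, IsCornerFace D j F := fun ⟨j, hj⟩ => hnc j hj
    unfold Xor
    exact ⟨fun _ => Or.inr rfl, fun _ => Or.inr ⟨rfl, hP⟩⟩
  · unfold Xor
    constructor
    · rintro (⟨hc, -⟩ | ⟨hs', -⟩)
      · exact Or.inl hc
      · exact absurd hs' hF
    · rintro (hc | hs')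
      · exact Or.inl ⟨hc, hF⟩
      · exact absurd hs' hF

include hv in
/-- neither face of an interior edge is a corner face. [cite: BollobasRiordan2006, Ch. 7 §7.2.2 (pp. 191–195)] -/
theorem not_mem_corners_of_interior {s : HexVertex} (hs : s ∈ ({v, oppFace v i} : Finset HexVertex)) : s ∉ corners D := by
  rw [not_mem_corners_iff]
  intro j hj
  exact not_isCornerFace_of_mem_pair₅ hv i hs j hj

include hv in
/-- ★ **the pattern ↔ matching DICTIONARY at five marks**: for a configuration of the XOR space whose strand from `s` ends at `y_j`, the link
relation is the ADJACENT pairs seen from `j` iff `y_{j+1} ~ y_{j+2}` (the five-point class `(j, A)`), and the NESTED pairs iff `y_{j+1} ~ y_{j+4}`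
(class `(j, B)`). [cite: KhristoforovSmirnov2021, §1.2 (arXiv v1 pp. 2–3: the link pattern; «matching marked points»)] -/
theorem linkRel_eq_adjRel₅_iff {s : HexVertex} (hs : s ∈ ({v, oppFace v i} : Finset HexVertex)) {ξ : Finset (Sym2 (Site 2))}
    (hξ : ξ ∈ TXb D v i s) {j : Fin 5} (hj : InClassX D (faceVertex v (i + 1)) (faceVertex v (i + 2)) s j ξ) :
    (linkRel D ξ = adjRel₅ j ↔ XiLinked ξ (yc D (j + 1)) (yc D (j + 2))) ∧
      (linkRel D ξ = nestRel₅ j ↔ XiLinked ξ (yc D (j + 1)) (yc D (j + 4))) := by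
  have hP : IsPattern j (linkRel D ξ) :=
    isPattern_linkRel (allSides_of_subset hv) hs (not_mem_corners_of_interior hv i hs) hξ hj
  obtain ⟨n12, n14, hA, hAn, hB, hBn⟩ := fin5_pairs j
  rcases relation_five hP with hL | hL
  · refine ⟨⟨fun _ => ?_, fun _ => hL⟩, ⟨fun h => ?_, fun h => ?_⟩⟩
    · have := hL ▸ hA
      exact (mem_linkRel.1 this).2
    · rw [hL] at h
      have key : ∀ j : Fin 5, adjRel₅ j ≠ nestRel₅ j := by unfold adjRel₅ nestRel₅; decide
      exact absurd h (key j)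
    · have hmem : (j + 1, j + 4) ∈ linkRel D ξ := mem_linkRel.2 ⟨n14, h⟩
      rw [hL] at hmem
      exact absurd hmem hBn
  · refine ⟨⟨fun h => ?_, fun h => ?_⟩, ⟨fun _ => ?_, fun _ => hL⟩⟩
    · rw [hL] at h
      have key : ∀ j : Fin 5, nestRel₅ j ≠ adjRel₅ j := by unfold adjRel₅ nestRel₅; decide
      exact absurd h (key j)
    · have hmem : (j + 1, j + 2) ∈ linkRel D ξ := mem_linkRel.2 ⟨n12, h⟩
      rw [hL] at hmem
      exact absurd hmem hAn
    · have := hL ▸ hB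
      exact (mem_linkRel.1 this).2

include hv in
/-- ★ **the five-point class `(j, M)` = «strand to `y_j`» ∧ «link relation = adjacent / nested pairs seen from `j`».**
[cite: KhristoforovSmirnov2021, §1.2 (arXiv v1 pp. 2–3)] -/
theorem inClass_iff_inClassX_and_linkRel {s : HexVertex} (hs : s ∈ ({v, oppFace v i} : Finset HexVertex)) (j : Fin 5) (m : Bool)
    {ξ : Finset (Sym2 (Site 2))} (hξ : ξ ∈ TXb D v i s) :
    FivePoint.N5.InClass D (faceVertex v (i + 1)) (faceVertex v (i + 2)) s j m ξ ↔
      InClassX D (faceVertex v (i + 1)) (faceVertex v (i + 2)) s j ξ ∧ linkRel D ξ = (if m then nestRel₅ j else adjRel₅ j) := by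
  have hξ6 : ξ ∈ FivePoint.N5.loopSpace6 D (faceVertex v (i + 1)) (faceVertex v (i + 2)) s := by
    rw [← txb_eq_loopSpace6₅ hv i hs]; exact hξ
  constructor
  · rintro ⟨-, ⟨Y, hY, hlink⟩, ⟨Y₁, Y₂, hY₁, hY₂, hl⟩⟩
    have hX : InClassX D (faceVertex v (i + 1)) (faceVertex v (i + 2)) s j ξ := ⟨hξ, Y, hY, hlink⟩
    refine ⟨hX, ?_⟩
    have e1 : Y₁ = yc D (j + 1) := eq_yc D hY₁
    obtain ⟨hAiff, hBiff⟩ := linkRel_eq_adjRel₅_iff hv i hs hξ hX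
    cases m
    · have hY₂' : FivePoint.IsCornerFace D (j + 2) Y₂ := by simpa using hY₂
      have e2 : Y₂ = yc D (j + 2) := eq_yc D ((isCornerFace_iff₅ _ _).2 hY₂')
      simp only [Bool.false_eq_true, ↓reduceIte]
      exact hAiff.2 (e1 ▸ e2 ▸ hl)
    · have hY₂' : FivePoint.IsCornerFace D (j + 4) Y₂ := by simpa using hY₂
      have e2 : Y₂ = yc D (j + 4) := eq_yc D ((isCornerFace_iff₅ _ _).2 hY₂')
      simp only [↓reduceIte]
      exact hBiff.2 (e1 ▸ e2 ▸ hl)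
  · rintro ⟨hX, hL⟩
    obtain ⟨-, Y, hY, hlink⟩ := hX
    refine ⟨hξ6, ⟨Y, hY, hlink⟩, ⟨yc D (j + 1), yc D (if m then j + 4 else j + 2), yc_spec D _, yc_spec D _, ?_⟩⟩
    obtain ⟨hAiff, hBiff⟩ := linkRel_eq_adjRel₅_iff hv i hs hξ ⟨hξ, Y, hY, hlink⟩
    cases m
    · simp only [Bool.false_eq_true, ↓reduceIte] at hL ⊢
      exact hAiff.1 hL
    · simp only [↓reduceIte] at hL ⊢
      exact hBiff.1 hL

/-! ### Counts: pattern counts are five-point class counts, hence `2^{#G}` × pattern probabilities -/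

include hv in
/-- the five-point transport hypotheses at the edge `{v, oppFace v i}` of an interior face. [folklore] -/
private theorem interiorEdge_facts₅ : hexGraph.Adj v (oppFace v i) ∧ faceEdge v (oppFace v i) = {faceVertex v (i + 1), faceVertex v (i + 2)} ∧
    faceVertex v (i + 1) ∈ D.verts ∧ faceVertex v (i + 2) ∈ D.verts :=
  ⟨hexGraph_adj_oppFace v i, faceEdge_oppFace v i, hv (faceVertex_mem v _), hv (faceVertex_mem v _)⟩

include hv in
open Classical in
/-- ★ **pattern count = five-point class count = `2^{#G}` × pattern probability**: for the pattern `(j; adjacent pairs)` (class `(j, A)`,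
`m = false`) resp. `(j; nested pairs)` (class `(j, B)`, `m = true`), at an interior edge, for every colour convention `c`.
[cite: KhristoforovSmirnov2021, §1.2 Lemma 2 (arXiv v1 pp. 3–4: colourings ↔ loop configurations), five-disorder analogue = the lane's (N) transport] -/
theorem patternCount_five_eq (c : Bool) (j : Fin 5) (m : Bool) (p : Pat 5) (hp : p.1 = (j, if m then nestRel₅ j else adjRel₅ j)) :
    (patternCount D v i p : ℝ) = 2 ^ #D.verts * patternProb D j c m v (oppFace v i) := by
  obtain ⟨hadj, he, h1, h2⟩ := interiorEdge_facts₅ hv i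
  have hT := FivePoint.N5.sixTransport_holds D v (oppFace v i) _ _ hv hadj he h1 h2 c j m
  have hP := FivePoint.N5.ha_patternProb_eq_card_div D j c m v (oppFace v i)
  -- the two filters agree, half by half
  have key : ∀ s ∈ ({v, oppFace v i} : Finset HexVertex),
      #((TXb D v i s).filter fun ξ => InClassX D (faceVertex v (i + 1)) (faceVertex v (i + 2)) s p.1.1 ξ ∧ linkRel D ξ = p.1.2) =
        #((FivePoint.N5.loopSpace6 D (faceVertex v (i + 1)) (faceVertex v (i + 2)) s).filter
            fun ξ => FivePoint.N5.InClass D (faceVertex v (i + 1)) (faceVertex v (i + 2)) s j m ξ) := by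
    intro s hs
    rw [← txb_eq_loopSpace6₅ hv i hs]
    congr 1
    refine Finset.filter_congr fun ξ hξ => ?_
    rw [inClass_iff_inClassX_and_linkRel hv i hs j m hξ, hp]
  have h2pow : (2 : ℝ) ^ #D.verts ≠ 0 := pow_ne_zero _ two_ne_zero
  unfold patternCount
  rw [key v (by simp), key (oppFace v i) (by simp), ← hT] at *
  rw [hP]
  field_simp

/-! ### The fan weight on the patterns of five corners -/

/-- the pattern `(j; adjacent pairs)`. [cite: KhristoforovSmirnov2021, §1.2 (arXiv v1 p. 2)] -/
def adjPat₅ (j : Fin 5) : Pat 5 := ⟨(j, adjRel₅ j), isPattern_adjRel₅ j⟩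

/-- the fan weight on the adjacent patterns: `τ²` at `(1; {2,3},{4,0})`, zero at the other four. [cite: KhristoforovSmirnov2021, §2 Definition 3 (arXiv v1 p. 4)] -/
theorem fanWt_two_adjRel₅ (m : Fin 5) : fanWt 2 m (adjRel₅ m) = if m = 1 then tau ^ 2 else 0 := by
  have key : ∀ m : Fin 5, (m.val ≤ 2 ∧ adjRel₅ m = fanRel 2 m.val) ↔ m = 1 := by
    unfold adjRel₅ fanRel; decide
  unfold fanWt
  by_cases h : m.val ≤ 2 ∧ adjRel₅ m = fanRel 2 m.val
  · rw [if_pos h, if_pos ((key m).1 h), (key m).1 h]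
    show -(-tau ^ 2) ^ (1 : ℕ) = tau ^ 2
    ring
  · rw [if_neg h, if_neg (fun e => h ((key m).2 e))]

/-- ★ **the fan weight restricted to the patterns of five corners** is supported on three patterns: `τ²` at `(1; adjacent)`, `−1` at
`(0; nested)` (the rainbow), `−τ⁴` at `(2; nested)`. [cite: KhristoforovSmirnov2021, §2 Definition 3 (arXiv v1 p. 4); Remark 6 (p. 5)] -/
theorem restrictW_fanWt_two (p : Pat 5) : restrictW (fanWt 2) p =
    (if p = adjPat₅ 1 then tau ^ 2 else 0) + (if p = nestPat₅ 0 then -1 else 0) + (if p = nestPat₅ 2 then -tau ^ 4 else 0) := by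
  obtain ⟨⟨j, L⟩, hP⟩ := p
  have hP' : IsPattern j L := hP
  have pairs : ∀ j : Fin 5, ((j, adjRel₅ j) = ((1 : Fin 5), adjRel₅ 1) ↔ j = 1) ∧ (j, adjRel₅ j) ≠ ((0 : Fin 5), nestRel₅ 0) ∧
      (j, adjRel₅ j) ≠ ((2 : Fin 5), nestRel₅ 2) ∧ (j, nestRel₅ j) ≠ ((1 : Fin 5), adjRel₅ 1) ∧
      ((j, nestRel₅ j) = ((0 : Fin 5), nestRel₅ 0) ↔ j = 0) ∧ ((j, nestRel₅ j) = ((2 : Fin 5), nestRel₅ 2) ↔ j = 2) := by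
    unfold adjRel₅ nestRel₅; decide
  obtain ⟨a1, a0, a2, n1, n0, n2⟩ := pairs j
  show fanWt 2 j L = _
  simp only [Subtype.ext_iff, adjPat₅, nestPat₅]
  rcases relation_five hP' with rfl | rfl
  · rw [fanWt_two_adjRel₅]
    simp only [a1, a0, a2, if_false, add_zero]
  · rw [fanWt_two_nestRel₅]
    simp only [n1, n0, n2, if_false, zero_add]
    have hj : ∀ j : Fin 5, j = 0 ∨ j = 2 ∨ (j ≠ 0 ∧ j ≠ 2) := by decide
    rcases hj j with rfl | rfl | ⟨h0, h2⟩
    · simp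
    · simp
    · simp [h0, h2]

/-! ### The identification -/

include hv in
/-- ★★★ **THE FAN IS THE FIVE-POINT OBSERVABLE**: at every edge of an interior face of a five-marked domain and for every colour convention,
`ObsW D (fanWt 2) v i = 2^{#G} · τ² · F₁(v, oppFace v i)`, where `F₁ = H_{1,A} − τ² H_{2,B} − τ H_{0,B}` is the lane's sparse five-point
observable (`FiveMarkedLoops.sparseObs`). The generic-`k` fan of HOLO-K, at `k = 5`, is the blind-found observable of the five-point files.
[cite: KhristoforovSmirnov2021, §2 Definition 3 (arXiv v1 p. 4: `F = Σ_j τ^j H_j`, three disorders); §1.2 (pp. 2–3); the five-disorder objects are the lane's] -/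
theorem obsW_fanWt_two_eq (c : Bool) : ObsW D (fanWt 2) v i = 2 ^ #D.verts * tau ^ 2 * sparseObs D 1 c v (oppFace v i) := by
  classical
  have hvA : AllSides D v := allSides_of_subset hv
  have hvc : v ∉ corners D := not_mem_corners_of_interior hv i (by simp)
  have hoc : oppFace v i ∉ corners D := not_mem_corners_of_interior hv i (by simp)
  rw [← obsW_classWt_restrictW (fanWt 2) hvA hvc hoc, obsW_classWt_eq_sum_patternCount _ hvA hvc hoc]
  simp only [restrictW_fanWt_two, add_mul, Finset.sum_add_distrib, ite_mul, zero_mul, Finset.sum_ite_eq', Finset.mem_univ, if_true]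
  -- the three pattern counts
  have c1 := patternCount_five_eq hv i c 1 false (adjPat₅ 1) rfl
  have c0 := patternCount_five_eq hv i c 0 true (nestPat₅ 0) rfl
  have c2 := patternCount_five_eq hv i c 2 true (nestPat₅ 2) rfl
  have c1' : (patternCount D v i (adjPat₅ 1) : ℂ) = 2 ^ #D.verts * (patternProb D 1 c false v (oppFace v i) : ℂ) := by exact_mod_cast c1
  have c0' : (patternCount D v i (nestPat₅ 0) : ℂ) = 2 ^ #D.verts * (patternProb D 0 c true v (oppFace v i) : ℂ) := by exact_mod_cast c0
  have c2' : (patternCount D v i (nestPat₅ 2) : ℂ) = 2 ^ #D.verts * (patternProb D 2 c true v (oppFace v i) : ℂ) := by exact_mod_cast c2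
  rw [c1', c0', c2']
  unfold FivePoint.sparseObs
  have e12 : (1 : Fin 5) + 1 = 2 := rfl
  have e14 : (1 : Fin 5) + 4 = 0 := rfl
  rw [e12, e14]
  have h3 : tau ^ 3 = 1 := by
    have hprim : IsPrimitiveRoot tau 3 := by
      have h := Complex.isPrimitiveRoot_exp 3 (by norm_num)
      unfold tau; convert h using 2; push_cast; ring
    exact hprim.pow_eq_one
  linear_combination (2 ^ #D.verts * (patternProb D 0 c true v (oppFace v i) : ℂ)) * h3

include hv in
/-- ★★ **COROLLARY — A SECOND PROOF OF THE LANE'S FIVE-POINT HOLOMORPHICITY (H) FOR `F₁`, FROM THE GENERIC MECHANISM**: HOLO-K's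
`holomorphicW_fan 2` (the fan obeys the tripod law, every `k`) and the identification give `Σ_i τ^i F₁(v, oppFace v i) = 0` at every interior face
(the tree's `hexFivePointHolomorphy_holds` states the same contour identity with the neighbours indexed by `ccwNbr`).
[cite: KhristoforovSmirnov2021, §2 Lemma 4 (arXiv v1 p. 4), five-disorder analogue] -/
theorem fivePoint_holomorphy_of_fan (c : Bool) : ∑ i : Fin 3, tau ^ (i : ℕ) * sparseObs D 1 c v (oppFace v i) = 0 := by
  have h := holomorphicW_fan 2 D v (allSides_of_subset hv)
  simp only [obsW_fanWt_two_eq hv _ c] at h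
  have h2 : (2 : ℂ) ^ #D.verts * tau ^ 2 ≠ 0 := by
    refine mul_ne_zero (pow_ne_zero _ two_ne_zero) (pow_ne_zero _ ?_)
    intro h0
    have hprim : IsPrimitiveRoot tau 3 := by
      have h := Complex.isPrimitiveRoot_exp 3 (by norm_num)
      unfold tau; convert h using 2; push_cast; ring
    have := hprim.pow_eq_one
    rw [h0] at this; norm_num at this
  have key : (2 : ℂ) ^ #D.verts * tau ^ 2 * ∑ i : Fin 3, tau ^ (i : ℕ) * sparseObs D 1 c v (oppFace v i) = 0 := by
    rw [Finset.mul_sum]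
    convert h using 2 with i
    ring
  exact (mul_eq_zero.1 key).resolve_left h2

end FanFivePoint

/-! ### The rotated fans are the rotated five-point observables -/
section Rotations

variable {D : TriMarkedDomain 5}

/-- the six-odd-point space of the rotated domain is that of the domain (same sites, same set of corner faces).
[cite: KhristoforovSmirnov2021, §1.2 (arXiv v1 pp. 2–3); BollobasRiordan2006, Ch. 7 §7.2.3 p. 197 (re-marking by relabelling)] -/
theorem loopSpace6_rotate (u w : Site 2) (s : HexVertex) :
    FivePoint.N5.loopSpace6 D.rotate u w s = FivePoint.N5.loopSpace6 D u w s := by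
  classical
  unfold FivePoint.N5.loopSpace6
  have hb : FivePoint.hBonds D.rotate = FivePoint.hBonds D := rfl
  rw [hb]
  have hc : ∀ F : HexVertex, (∃ j, FivePoint.IsCornerFace D.rotate j F) ↔ ∃ j, FivePoint.IsCornerFace D j F :=
    fun F => rotate_exists_isCornerFace D F
  refine Finset.filter_congr fun ξ _ => forall₂_congr fun F _ => ?_
  exact iff_congr Iff.rfl (or_congr (hc F) Iff.rfl)

/-- the five-point classes of the rotated domain are the shifted classes: `(j, M)` for `D.rotate` = `(j+1, M)` for `D`.
[cite: KhristoforovSmirnov2021, §1.2 (arXiv v1 pp. 2–3); BollobasRiordan2006, Ch. 7 §7.2.3 p. 197] -/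
theorem inClass_rotate (u w : Site 2) (s : HexVertex) (j : Fin 5) (m : Bool) (ξ : Finset (Sym2 (Site 2))) :
    FivePoint.N5.InClass D.rotate u w s j m ξ ↔ FivePoint.N5.InClass D u w s (j + 1) m ξ := by
  unfold FivePoint.N5.InClass
  rw [loopSpace6_rotate]
  have hc : ∀ (i : Fin 5) (F : HexVertex), FivePoint.IsCornerFace D.rotate i F ↔ FivePoint.IsCornerFace D (i + 1) F :=
    fun i F => rotate_isCornerFace D i F
  have e : (if m then j + 4 else j + 2) + 1 = (if m then j + 1 + 4 else j + 1 + 2) := by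
    cases m
    · show j + 2 + 1 = j + 1 + 2
      have : ∀ j : Fin 5, j + 2 + 1 = j + 1 + 2 := by decide
      exact this j
    · show j + 4 + 1 = j + 1 + 4
      have : ∀ j : Fin 5, j + 4 + 1 = j + 1 + 4 := by decide
      exact this j
  simp only [hc, e]

/-- ★ **the pattern probabilities of the rotated domain are the shifted ones**: `H_{j,M}` for `D.rotate` = `H_{j+1,M}` for `D`, at every interior edge
and for every colour convention — proved on the LOOP side (five-point transport for both domains + `inClass_rotate`), no percolation-side relabelling needed.
[cite: KhristoforovSmirnov2021, §1.2 Lemma 2 (arXiv v1 pp. 3–4); BollobasRiordan2006, Ch. 7 §7.2.3 p. 197] -/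
theorem patternProb_rotate {v : HexVertex} (hv : hexFaceVertices v ⊆ D.verts) (i : Fin 3) (j : Fin 5) (c m : Bool) :
    patternProb D.rotate j c m v (oppFace v i) = patternProb D (j + 1) c m v (oppFace v i) := by
  classical
  obtain ⟨hadj, he, h1, h2⟩ := interiorEdge_facts₅ hv i
  have hv' : hexFaceVertices v ⊆ D.rotate.verts := hv
  have hT := FivePoint.N5.sixTransport_holds D.rotate v (oppFace v i) _ _ hv' hadj he h1 h2 c j m
  have hT' := FivePoint.N5.sixTransport_holds D v (oppFace v i) _ _ hv hadj he h1 h2 c (j + 1) m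
  have hP := FivePoint.N5.ha_patternProb_eq_card_div D.rotate j c m v (oppFace v i)
  have hP' := FivePoint.N5.ha_patternProb_eq_card_div D (j + 1) c m v (oppFace v i)
  have hVr : D.rotate.verts = D.verts := rfl
  -- the class counts agree by `inClass_rotate`
  have key : ∀ s : HexVertex,
      #((FivePoint.N5.loopSpace6 D.rotate (faceVertex v (i + 1)) (faceVertex v (i + 2)) s).filter
          fun ξ => FivePoint.N5.InClass D.rotate (faceVertex v (i + 1)) (faceVertex v (i + 2)) s j m ξ) =
        #((FivePoint.N5.loopSpace6 D (faceVertex v (i + 1)) (faceVertex v (i + 2)) s).filter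
          fun ξ => FivePoint.N5.InClass D (faceVertex v (i + 1)) (faceVertex v (i + 2)) s (j + 1) m ξ) := by
    intro s
    rw [loopSpace6_rotate]
    congr 1
    exact Finset.filter_congr fun ξ _ => inClass_rotate _ _ s j m ξ
  rw [hP, hP', ← hT, ← hT', key, key]
  rfl

/-- hence the sparse observable of the rotated domain is the shifted one: `F_j` for `D.rotate` = `F_{j+1}` for `D`.
[cite: KhristoforovSmirnov2021, §2 Definition 3 (arXiv v1 p. 4), five-disorder analogue] -/
theorem sparseObs_rotate {v : HexVertex} (hv : hexFaceVertices v ⊆ D.verts) (i : Fin 3) (j : Fin 5) (c : Bool) :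
    sparseObs D.rotate j c v (oppFace v i) = sparseObs D (j + 1) c v (oppFace v i) := by
  unfold FivePoint.sparseObs
  rw [patternProb_rotate hv, patternProb_rotate hv, patternProb_rotate hv]
  have e1 : j + 1 + 1 = j + 1 + 1 := rfl
  have e4 : ∀ j : Fin 5, j + 4 + 1 = j + 1 + 4 := by decide
  rw [e4]

/-- iterating: the observable of the `m`-fold back-rotated fan is that of the fan on the `m`-fold rotated domain.
[cite: KhristoforovSmirnov2021, §2 Definition 3 (arXiv v1 p. 4); BollobasRiordan2006, Ch. 7 §7.2.3 p. 197] -/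
theorem obsW_iterate_rotW_symm (wt : Fin 5 → Finset (Fin 5 × Fin 5) → ℂ) (m : ℕ) (D : TriMarkedDomain 5) (v : HexVertex) (i : Fin 3) :
    ObsW D ((rotW (rot 5).symm)^[m] wt) v i = ObsW (TriMarkedDomain.rotate^[m] D) wt v i := by
  induction m generalizing wt with
  | zero => rfl
  | succ m ih => rw [Function.iterate_succ_apply, ih, Function.iterate_succ_apply', obsW_rotate]

open Fin.NatCast in
/-- the sparse observable on the `m`-fold rotated domain. [cite: KhristoforovSmirnov2021, §2 Definition 3 (arXiv v1 p. 4), five-disorder analogue] -/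
theorem sparseObs_iterate_rotate {v : HexVertex} (i : Fin 3) (j : Fin 5) (c : Bool) (m : ℕ) :
    ∀ (D : TriMarkedDomain 5), hexFaceVertices v ⊆ D.verts →
      sparseObs (TriMarkedDomain.rotate^[m] D) j c v (oppFace v i) = sparseObs D (j + (m : Fin 5)) c v (oppFace v i) := by
  induction m generalizing j with
  | zero => intro D _; rw [Function.iterate_zero_apply, Nat.cast_zero, add_zero]
  | succ m ih =>
    intro D hv
    rw [Function.iterate_succ_apply, ih j D.rotate hv, sparseObs_rotate hv, Nat.cast_succ, add_assoc]

/-- the iterated back-rotation is the transport along a power of `rot⁻¹`. [cite: KhristoforovSmirnov2021, §1.2 (arXiv v1 p. 2: cyclic indexing)] -/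
theorem iterate_rotW_symm_eq (wt : Fin 5 → Finset (Fin 5 × Fin 5) → ℂ) (m : ℕ) :
    (rotW (rot 5).symm)^[m] wt = rotW ((rot 5).symm ^ m) wt := by
  induction m with
  | zero =>
    funext j L
    show wt j L = wt ((1 : Equiv.Perm (Fin 5)) j) (relMap 1 L)
    rw [Equiv.Perm.one_apply]
    congr 1
    exact (relMap_refl L).symm
  | succ m ih =>
    rw [Function.iterate_succ_apply', ih, rotW_rotW, pow_succ]
    rfl

/-- the fifth power of the rotation of five marks is the identity, so `rot^s = (rot⁻¹)^(5−s)`. [folklore] -/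
private theorem rot_pow_eq_symm_pow (s : Fin 5) : rot 5 ^ s.val = (rot 5).symm ^ (5 - s.val) := by
  have h5 : rot 5 ^ 5 = 1 := by decide
  have hs : s.val ≤ 5 := s.isLt.le
  have key : rot 5 ^ s.val * rot 5 ^ (5 - s.val) = 1 := by rw [← pow_add, Nat.add_sub_cancel' hs, h5]
  have hsymm : (rot 5).symm = (rot 5)⁻¹ := rfl
  rw [hsymm, inv_pow]
  exact eq_inv_of_mul_eq_one_left key

open Fin.NatCast in
/-- ★★★ **THE ROTATED FANS ARE THE ROTATED FIVE-POINT OBSERVABLES**: for every `s : Fin 5`, at every edge of an interior face and for every colour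
convention, `ObsW D (rotW (rot 5 ^ s) (fanWt 2)) v i = 2^{#G} · τ² · F_{1−s}(v, oppFace v i)` (indices in `ℤ/5`).
[cite: KhristoforovSmirnov2021, §2 Definition 3 (arXiv v1 p. 4); Remark 6 (p. 5); the five-disorder objects are the lane's] -/
theorem obsW_rotW_fanWt_two_eq {v : HexVertex} (hv : hexFaceVertices v ⊆ D.verts) (i : Fin 3) (c : Bool) (s : Fin 5) :
    ObsW D (rotW (rot 5 ^ s.val) (fanWt 2)) v i = 2 ^ #D.verts * tau ^ 2 * sparseObs D (1 - s) c v (oppFace v i) := by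
  rw [rot_pow_eq_symm_pow, ← iterate_rotW_symm_eq, obsW_iterate_rotW_symm]
  have hv' : hexFaceVertices v ⊆ (TriMarkedDomain.rotate^[5 - s.val] D).verts := by
    have : ∀ (m : ℕ) (D : TriMarkedDomain 5), (TriMarkedDomain.rotate^[m] D).verts = D.verts := by
      intro m; induction m with
      | zero => intro D; rfl
      | succ m ih => intro D; rw [Function.iterate_succ_apply', rotate_verts, ih]
    rw [this]; exact hv
  rw [obsW_fanWt_two_eq hv' i c, sparseObs_iterate_rotate i 1 c (5 - s.val) D hv]
  have hverts : #(TriMarkedDomain.rotate^[5 - s.val] D).verts = #D.verts := by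
    have : ∀ (m : ℕ) (D : TriMarkedDomain 5), (TriMarkedDomain.rotate^[m] D).verts = D.verts := by
      intro m; induction m with
      | zero => intro D; rfl
      | succ m ih => intro D; rw [Function.iterate_succ_apply', rotate_verts, ih]
    rw [this]
  rw [hverts]
  congr 2
  -- `1 + (5 − s) = 1 − s` in `ℤ/5`
  have e : ∀ s : Fin 5, (1 : Fin 5) + ((5 - s.val : ℕ) : Fin 5) = 1 - s := by decide
  exact e s

end Rotations

/-! ### Classification of the discretely holomorphic five-disorder observables -/
section Classification

/-- ★★★ **CLASSIFICATION**: a five-disorder class weight is discretely holomorphic on EVERY five-marked domain iff, on the patterns, it is a linear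
combination of the five rotated fans (TRIPOD-NECESSITY-FIVE `tripodLaw_iff_forall_holomorphicW_five` ⊕ TRIPOD-SOLVED-FIVE
`tripodLaw_five_iff_exists_sum_fanR`); with `obsW_fanWt_two_eq` the unrotated member is `τ²·F₁`. The solution space is five-dimensional
(`finrank_solW_five`). [cite: KhristoforovSmirnov2021, §2 Definition 3 and Lemma 4 (arXiv v1 p. 4); Remark 6 (p. 5); the five-disorder statement is the lane's] -/
theorem forall_holomorphicW_iff_exists_sum_fanR (wt : Fin 5 → Finset (Fin 5 × Fin 5) → ℂ) :
    (∀ D : TriMarkedDomain 5, HolomorphicW D wt) ↔ ∃ g : Fin 5 → ℂ, restrictW wt = ∑ s : Fin 5, g s • fanR s := by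
  rw [← tripodLaw_iff_forall_holomorphicW_five, tripodLaw_five_iff_exists_sum_fanR]

/-- ★★ and the observable of such a weight at an edge of an all-sides face whose two faces are not corners is the same combination of the
rotated fans' observables (the observable sees only the pattern values: `obsW_classWt_restrictW`, linearity `obsWLin`).
[cite: KhristoforovSmirnov2021, §2 Definition 3 (arXiv v1 p. 4: `F(z) = E[H(ξ)]`)] -/
theorem obsW_eq_sum_of_forall_holomorphicW {D : TriMarkedDomain 5} {wt : Fin 5 → Finset (Fin 5 × Fin 5) → ℂ}
    (h : ∀ D : TriMarkedDomain 5, HolomorphicW D wt) {v : HexVertex} (hv : AllSides D v) {i : Fin 3} (hvc : v ∉ corners D)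
    (hoc : oppFace v i ∉ corners D) :
    ∃ g : Fin 5 → ℂ, ObsW D wt v i = ∑ s : Fin 5, g s * ObsW D (rotW (rot 5 ^ s.val) (fanWt 2)) v i := by
  obtain ⟨g, hg⟩ := (forall_holomorphicW_iff_exists_sum_fanR wt).1 h
  refine ⟨g, ?_⟩
  rw [← obsW_classWt_restrictW wt hv hvc hoc, hg, ← obsWLin_apply, ← classWtLin_apply, map_sum, map_sum]
  refine Finset.sum_congr rfl fun s _ => ?_
  rw [map_smul, map_smul, smul_eq_mul, classWtLin_apply, obsWLin_apply]
  unfold fanR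
  rw [obsW_classWt_restrictW _ hv hvc hoc]

/-- ★★★★ **THE DISCRETELY HOLOMORPHIC FIVE-DISORDER OBSERVABLES ARE THE COMBINATIONS OF THE LANE'S FIVE OBSERVABLES `F_0, …, F_4`**: if a
five-disorder class weight is discretely holomorphic on every five-marked domain then there are five numbers `g_s` with
`ObsW D wt v i = 2^{#G} · τ² · Σ_s g_s · F_{1−s}(v, oppFace v i)` at every edge of every interior face of every five-marked domain `D`, for every colour
convention `c` (NEC5 ⊕ SOLVED5 ⊕ the identification ⊕ the rotation bookkeeping). [cite: KhristoforovSmirnov2021, §2 Definition 3 and Lemma 4 (arXiv v1 p. 4); the five-disorder statement is the lane's] -/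
theorem obsW_eq_sum_sparseObs_of_forall_holomorphicW {wt : Fin 5 → Finset (Fin 5 × Fin 5) → ℂ} (h : ∀ D : TriMarkedDomain 5, HolomorphicW D wt) :
    ∃ g : Fin 5 → ℂ, ∀ (D : TriMarkedDomain 5) (v : HexVertex), hexFaceVertices v ⊆ D.verts → ∀ (i : Fin 3) (c : Bool),
      ObsW D wt v i = 2 ^ #D.verts * tau ^ 2 * ∑ s : Fin 5, g s * sparseObs D (1 - s) c v (oppFace v i) := by
  obtain ⟨g, hg⟩ := (forall_holomorphicW_iff_exists_sum_fanR wt).1 h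
  refine ⟨g, fun D v hv i c => ?_⟩
  have hvA : AllSides D v := allSides_of_subset hv
  have hvc : v ∉ corners D := not_mem_corners_of_interior hv i (by simp)
  have hoc : oppFace v i ∉ corners D := not_mem_corners_of_interior hv i (by simp)
  have key : ObsW D wt v i = ∑ s : Fin 5, g s * ObsW D (rotW (rot 5 ^ s.val) (fanWt 2)) v i := by
    rw [← obsW_classWt_restrictW wt hvA hvc hoc, hg, ← obsWLin_apply, ← classWtLin_apply, map_sum, map_sum]
    refine Finset.sum_congr rfl fun s _ => ?_
    rw [map_smul, map_smul, smul_eq_mul, classWtLin_apply, obsWLin_apply]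
    unfold fanR
    rw [obsW_classWt_restrictW _ hvA hvc hoc]
  rw [key, Finset.mul_sum]
  refine Finset.sum_congr rfl fun s _ => ?_
  rw [obsW_rotW_fanWt_two_eq hv i c s]
  ring

end Classification

end Literature.Probability.Percolation.MarkedLoops
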